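import Literature.Analysis.FluidPDE.PineauVicolOneSliceReductionK2
import Literature.Analysis.FluidPDE.PineauVicolSmallVorticityPropagation
import Literature.Analysis.FluidPDE.PineauVicolOneSliceVorticity
import HarnessLib

/-!
# Pineau–Vicol 2026, Theorem 1.9 — the discharge

`pineauVicol2026_oneSlice_regularity_holds : pineauVicol2026_oneSlice_regularity`, the named
fact of `PineauVicolOneSlice.lean` ([PineauVicol2026, Thm. 1.9]: interior regularity of Type I
solutions that are approximately self-similar on one time-slice), assembled from

* `pineauVicol2026_oneSlice_regularity_of_core'` (`PineauVicolOneSliceReductionK2`) — the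
  reduction of the printed proof (§9.2, Prop. 9.5, (9.15)–(9.16), Lemma 9.2/Cor. 9.3, the CKN
  criterion) to the two analytic inputs below;
* `pineauVicol_smallVorticity_propagation` (`PineauVicolSmallVorticityPropagation`) —
  Lemma 9.4, propagation of small vorticity;
* `pineauVicol_oneSlice_vorticity_small` (`PineauVicolOneSliceVorticity`) — the one-slice
  smallness of the vorticity from (1.17) (§9.3, here by compactness and Tsai's Liouville theorem
  for `RSS_{α=0}`).

(A separate file because `PineauVicolOneSliceProofs.lean` is imported by the files above.)

## References

* B. Pineau, V. Vicol, *On rotated backwards self-similar solutions of the incompressible 3D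
  Navier–Stokes equations*, arXiv:2607.09619 (2026), Theorem 1.9 and §9. [PineauVicol2026]
-/

noncomputable section

namespace Literature.Analysis.FluidPDE

/-- **Pineau–Vicol, Theorem 1.9**: the named fact `pineauVicol2026_oneSlice_regularity` holds.
[cite: PineauVicol2026, Thm. 1.9, proof §9 pp. 29–35, arXiv:2607.09619] -/
theorem pineauVicol2026_oneSlice_regularity_holds : pineauVicol2026_oneSlice_regularity :=
  pineauVicol2026_oneSlice_regularity_of_core' pineauVicol_smallVorticity_propagation
    pineauVicol_oneSlice_vorticity_small

end Literature.Analysis.FluidPDE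

end
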